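import Mathlib
import Literature.NumberTheory.Sieve.BombieriFriedlanderIwaniecDispersion
import Summits.Parity.GeneralizedHardyLittlewood.Theses.LiouvilleShiftedTables

/-!
# Sketch — first lemmas of the crux-idea cards for `TypeI2Dilated` (stmt-Parity-14272)

planner-cruxidea-stmt-Parity-14272-1-0, round 1.  Nothing here is proved; the three `def … : Prop`
below only have to ELABORATE (crux-ideate protocol: "First lemma … need not be proved, it must
elaborate").  The crux itself is
`Summit.Parity.GeneralizedHardyLittlewood.Theses.LiouvilleShiftedTables.TypeI2Dilated`.

* `DrappeauTypeII`  — card `peel-to-drappeau`: Drappeau 2017 (PLMS 114, arXiv:1504.05549) Theorem 5.1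
  in crux coordinates (moduli = the smooth `s ∼ S`, rational residue `a₁ ā₂`, arbitrary
  divisor-bounded coefficients, conductor-truncated discrepancy `uR`).
* `LiouvilleCharacterMeanValue` — card `peel-to-drappeau`, main-term input: the Bombieri–Vinogradov
  mean value for `λ` twisted by primitive characters (classical: Vaughan/HB identity + large sieve).
* `DilatedDispG` — card `q-joins-r`: BFI 1986 Theorem 6 / (3.3) with the dilation modulus `q ∼ P`
  carried outside and the class `mn ≡ b (mod q)` inside both the progression term and the expected term.
-/

open Finset Real
open scoped ArithmeticFunction.sigma Classical

noncomputable section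

namespace Summit.Parity.GeneralizedHardyLittlewood.Cruxes.TypeI2Dilated.Sketch

open Literature.NumberTheory.Sieve Literature.NumberTheory.Sieve.BFI

-- the crux we answer to (by name)
#check @Summit.Parity.GeneralizedHardyLittlewood.Theses.LiouvilleShiftedTables.TypeI2Dilated

/-! ### Card 1 (`peel-to-drappeau`) -/

/-- Drappeau's conductor-truncated discrepancy `𝔲_R(t; d) = φ(d)⁻¹ ∑_{χ mod d, cond χ > R} χ(t)`
(arXiv:1504.05549 §5, first display): it vanishes for `d ≤ R` or `t` a non-unit, and
`𝔲_R(t;d) = (1_{t = 1} − φ(d)⁻¹ 1_{t unit}) − φ(d)⁻¹ ∑_{1 < cond χ ≤ R} χ(t)`.  Junk `0` at `d = 0`. -/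
def uR (R : ℝ) (d : ℕ) (t : ZMod d) : ℂ :=
  if h : d = 0 then 0 else
    haveI : NeZero d := ⟨h⟩
    ((Nat.totient d : ℂ))⁻¹ *
      ∑ χ : DirichletCharacter ℂ d, if R < (χ.conductor : ℝ) then χ t else 0

/-- **First lemma of `peel-to-drappeau`** = Drappeau 2017, Theorem 5.1, verbatim up to notation
(his `q ∼ Q` is our smooth modulus `s ∼ S`; his residue `mn ā₁ a₂` with `|a₁|, |a₂| ≤ x^δ` is our
rational residue `c · ḡ`, `g = gcd(b, q_dil) · (r-part)`; his `R` is our conductor cutoff `Rd`):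
for `η > 0` there is `δ = δ(η) > 0` such that for divisor-bounded `α, β` (NO equidistribution
hypothesis), `MN = x`, `x^η ≤ N ≤ S^{2/3−η}`, `x^{1/4} ≤ S ≤ x^{1/2+δ}`, `Rd, |a₁|, |a₂| ≤ x^δ`:
`∑_{s∼S,(s,a₁a₂)=1} ∑_{m∼M} ∑_{n∼N,(n,a₂)=1} α_m β_n 𝔲_{Rd}(mn ā₁ a₂; s) ≪ x (log x)^{O(1)} Rd⁻¹`.
In the line, `α := (λ-piece)·χ`, `β := (λ-piece)·χ` for a Dirichlet character `χ mod q_dil/g`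
(the unit part of the dilation class), which is an INSTANCE since `α, β` are arbitrary.
[cite: Drappeau2017, Thm 5.1] -/
def DrappeauTypeII : Prop :=
  ∀ η : ℝ, 0 < η → ∃ δ : ℝ, 0 < δ ∧ ∀ Aτ : ℝ, 0 ≤ Aτ → ∃ C c₀ x₀ : ℝ, ∀ x : ℝ, x₀ ≤ x →
    ∀ M N S Rd : ℝ, M * N = x → x ^ η ≤ N → N ≤ S ^ (2 / 3 - η) → x ^ (1 / 4 : ℝ) ≤ S →
      S ≤ x ^ (1 / 2 + δ) → 1 ≤ Rd → Rd ≤ x ^ δ →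
    ∀ a₁ a₂ : ℤ, a₁ ≠ 0 → a₂ ≠ 0 → (|a₁| : ℝ) ≤ x ^ δ → (|a₂| : ℝ) ≤ x ^ δ →
    ∀ α β : ℕ → ℂ, (∀ m, ‖α m‖ ≤ (σ 0 m : ℝ) ^ Aτ) → (∀ n, ‖β n‖ ≤ (σ 0 n : ℝ) ^ Aτ) →
      ‖∑ s ∈ (dyadic S).filter (fun s : ℕ => IsCoprime (s : ℤ) (a₁ * a₂)),
          ∑ m ∈ dyadic M, ∑ n ∈ (dyadic N).filter (fun n : ℕ => IsCoprime (n : ℤ) a₂),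
            α m * β n *
              uR Rd s (((m * n : ℕ) : ZMod s) * ((a₁ : ZMod s))⁻¹ * ((a₂ : ZMod s)))‖ ≤
        C * x * Real.log x ^ c₀ / Rd

/-- **Main-term input of `peel-to-drappeau`** (classical Bombieri–Vinogradov mean value for the
Liouville function twisted by primitive characters; Vaughan/Heath-Brown identity for `μ`,
`λ = μ ∗ 1_□`, the multiplicative large sieve `Literature.NumberTheory.Sieve.largeSieve_bilinear`
and Pólya–Vinogradov for the Type-I pieces):
`∑_{q∼Q} ∑*_{χ mod q} max_{y ≤ x} |∑_{m ≤ y} λ(m)χ(m)| ≤ C (x + x^{5/6} Q + x^{1/2} Q²)(log x)^{c₀}`.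
Only the range `(log x)^B < Q ≤ x^{δ'+4ρ}` is used (weight `1/Q` per dyadic block), together with
Siegel–Walfisz for `λ` (tree: `SiegelWalfiszMoebius_holds`) for conductors `≤ (log x)^B`.
[cite: IwaniecKowalski2004, Thm 17.? shape; Vaughan1980] -/
def LiouvilleCharacterMeanValue : Prop :=
  ∃ C c₀ x₀ : ℝ, ∀ x : ℝ, x₀ ≤ x → ∀ Q : ℝ, 1 ≤ Q → Q ≤ x →
    ∑ q ∈ dyadic Q, ∑ χ ∈ (Finset.univ : Finset (DirichletCharacter ℂ q)).filter
        (fun χ => χ.IsPrimitive),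
      (⨆ y : ↥(Set.Icc (1 : ℝ) x),
        ‖∑ m ∈ Icc 1 ⌊(y : ℝ)⌋₊, (ArithmeticFunction.liouville m : ℂ) * χ (m : ZMod q)‖) ≤
      C * (x + x ^ (5 / 6 : ℝ) * Q + x ^ (1 / 2 : ℝ) * Q ^ 2) * Real.log x ^ c₀

/-! ### Card 2 (`q-joins-r`) -/

/-- The dilated inner discrepancy at dispersion modulus `d = rs`, dilation modulus `q`, class `b`:
`∑_{n∼N, mn ≡ a (d), mn ≡ b (q)} β_n − φ(d)⁻¹ ∑_{n∼N, (n,d)=1, mn ≡ b (q)} β_n`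
(the class mod `q` is kept EXACT in both terms; only the `d`-constraint is dispersed). -/
def innerDiscDil (a b : ℤ) (N : ℝ) (β : ℕ → ℝ) (q d m : ℕ) : ℝ :=
  (∑ n ∈ dyadic N,
      if ((m * n : ℕ) : ZMod d) = (a : ZMod d) ∧ ((m * n : ℕ) : ZMod q) = (b : ZMod q)
      then β n else 0) -
    (∑ n ∈ dyadic N,
        if n.Coprime d ∧ ((m * n : ℕ) : ZMod q) = (b : ZMod q) then β n else 0) /
      (Nat.totient d : ℝ)

/-- The dilated `𝒢`-sum: BFI (3.3)'s `𝒢(M,N,Q,R)` with `γ ≡ 1` (Theorem 6's weights (A₇)), the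
dilation modulus `q ∼ P` summed OUTSIDE the square next to `r ∼ R` and `m ∼ M`. -/
def dispGDil (a b : ℤ) (M N S R P : ℝ) (β : ℕ → ℝ) : ℝ :=
  ∑ q ∈ dyadic P, ∑ r ∈ dyadic R, ∑ m ∈ dyadic M,
    if IsCoprime (r : ℤ) (a * m) then
      (∑ s ∈ dyadic S,
          if IsCoprime (s : ℤ) (a * m) then innerDiscDil a b N β q (r * s) m else 0) ^ 2
    else 0

/-- **First lemma of `q-joins-r`** ("the dilation modulus is a second rough modulus"): BFI 1986
Theorem 6 / (3.3) with `R ↦ P R` in the ranges and the saving `(R P)⁻¹`: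
for `a ≠ 0`, `ε, A > 0`, divisor exponent `B`, Siegel–Walfisz constants `Csw`, there are
`B₀ B₇ C x₀` with, for `x ≥ x₀`, `MN = x`, `x^ε ≤ N ≤ x^{1−ε}`, `S, R, P ≥ 1/2`,
`S R P < x ℒ^{−B₇}`, `x^ε P R < N < x^{−ε} (x/(PR))^{1/3}`, every `β` with (A₂) and (A₄), and EVERY
class `b`:  `dispGDil a b M N S R P β ≤ C ‖β‖² x (R P)⁻¹ ℒ^{−A}`
(trivial size `≍ ‖β‖² x (RP)⁻¹`; `P = 1/2` is Theorem 6 itself).  By Cauchy–Schwarz over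
`(q, r, m)` this bounds `∑_{q∼P} ∑_{r∼R} |∑_{s∼S} ∑_{mn ≡ a (rs), mn ≡ b (q)} α_m β_n − …|` by
`‖α‖‖β‖ x^{1/2} ℒ^{−A/2}`, uniformly in `b`, which is the Type-II input of the crux for the
block `q ∼ P`.  [cite: BombieriFriedlanderIwaniecActa1986, §13 Thm 6 and (13.2); Drappeau2017, Thm 2.1] -/
def DilatedDispG : Prop :=
  ∀ a : ℤ, a ≠ 0 → ∀ ε : ℝ, 0 < ε → ∀ A : ℝ, 0 < A → ∀ B : ℝ, 0 ≤ B → ∀ Csw : ℝ → ℝ,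
    ∃ B₀ B₇ C x₀ : ℝ, ∀ x : ℝ, x₀ ≤ x → ∀ M N S R P : ℝ,
      M * N = x → x ^ ε ≤ N → N ≤ x ^ (1 - ε) →
      1 / 2 ≤ S → 1 / 2 ≤ R → 1 / 2 ≤ P → S * R * P < x / Real.log x ^ B₇ →
      x ^ ε * (P * R) < N → N < x ^ (-ε) * (x / (P * R)) ^ (1 / 3 : ℝ) →
      ∀ β : ℕ → ℝ, SiegelWalfiszHyp N B Csw β → IsSifted (dyadic N) (Real.log x ^ B₀) β →
      ∀ b : ℤ,
        dispGDil a b M N S R P β ≤ C * l2Sq N β * x * (R * P)⁻¹ / Real.log x ^ A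

/-- Sanity: at `P = 1/2` the `q`-range of `dispGDil` is the single modulus `q = 1`, for which the
class constraint is vacuous — `q-joins-r` then literally restates BFI's `𝒢` (not proved here). -/
example : dyadic (1 / 2 : ℝ) = {1} := by
  ext q
  rw [mem_dyadic (by norm_num : (0:ℝ) ≤ 1 / 2), Finset.mem_singleton]
  constructor
  · rintro ⟨h1, h2⟩
    have h2' : (q : ℝ) ≤ 1 := by linarith
    have hq1 : q ≤ 1 := by exact_mod_cast h2'
    have hq0 : 0 < q := by exact_mod_cast (show (0:ℝ) < q by linarith)
    omega
  · rintro rfl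
    norm_num

end Summit.Parity.GeneralizedHardyLittlewood.Cruxes.TypeI2Dilated.Sketch
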